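import Summits.ValiantsHypothesis.ValiantsHypothesis.Theorems.KPlusLogSqLawTropicalBExchangeCarries

/-!
# Route «KPlusLogSqLaw», crux `TropicalB` (stmt-ValiantsHypothesis-19771) — the EXCHANGE SECTOR, part 4:
# single-permutation sub-patterns satisfy the exchange axiom; the exchange cover number is at most the permutation count

HONEST FRAMING.  Helper toward the registered stubs `stub_tropThin` / `stub_tropFat` of `Cruxes/TropicalB/Lines/birth.lean` (crux
`Summit.ValiantsHypothesis.ValiantsHypothesis.Theses.KPlusLogSqLaw.TropicalB`, item stmt-ValiantsHypothesis-19771, route KPlusLogSqLaw,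
DRAFT; cell `pub-symmetroid`, seat val-sym-trop-p1 g9, 2026-08-27; `--supports … --as helper`).  Continuation of parts 1–3
(`…TropicalBExchangeStage` / `…ExchangeSector` / `…ExchangeCarries`).  Structural statements about dominant chains of ARBITRARY designs; nothing
here bounds `TropicalB` in its window, and nothing bears on `WeakLifting`, DoorA26 / DoorA34, `MatrixDescartes` (stmt-ValiantsHypothesis-18050)
or VP ≠ VNP.

* `exchange_core` — the combinatorial heart (transportation exchange): for two class maps `λ, μ : Fin m → Fin K` and a class `i` that `λ`
  uses more often than `μ` on a column set `T`, there are a class `j` that `λ` uses less often on `T` and a column set `S ⊆ T` on which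
  swapping `λ` and `μ` trades exactly one `i` for one `j` (`cnt(λ|S) − cnt(μ|S) = e_i − e_j`).  Proof: follow the column `b₁` with
  `λ b₁ = i ≠ μ b₁ =: j₁`; either `j₁` already works with `S = {b₁}`, or `j₁` is again over-used by `λ` on `T ∖ {b₁}` and induction on `T`
  supplies the rest of the path (strong induction on the finset `T`; no re-indexing).
* `exchange_of_singlePerm` — hence the SINGLE-PERMUTATION SUB-PATTERN `εσ a b l = [a = σ b]·ε a b l` of ANY design satisfies the term-level
  exchange axiom (M-EXC) with EQUALITY in the value inequality (swap the classes of `p` and `q` on `S`): the separable / frozen-permutation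
  designs of `…TropicalBSeparable`, `…TropicalBClassUniform` are in the exchange sector, as located in part 2's header.
* `chain_succ_le_of_exchange_chainCover` — the cover law of part 3 with the cover required only for the CHAIN's terms.
* `chain_succ_le_card_perms_of_exchange` — covering a chain by the single-permutation sub-patterns of its own permutations re-derives the
  permutation-count law `…TropicalBSwitchBudget.chain_le_card_perms_mul` (`n + 1 ≤ #{σₖ}·(m(K−1)+1)`, here for sorted exponents and distinct
  consecutive terms) as an instance of the exchange machinery.  READING: the EXCHANGE COVER NUMBER of a design (least number of exchange
  sub-patterns covering its present terms, part 3) is a common refinement of «one» (class-uniform designs, any number of permutations) and of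
  the permutation count (every design); `n + 1 ≤ R_ex·(m(K−1)+1)`.  Nothing here bounds `R_ex` for general designs.
[kernel arguments: this file; (M-EXC): Murota, Discrete Convex Analysis (2003), Ch. 6; the transportation exchange is folklore]
-/

set_option linter.dupNamespace false
set_option autoImplicit false

namespace Summit.ValiantsHypothesis.ValiantsHypothesis.Theorems.KPlusLogSqLaw.ExchangeSector

open Summit.ValiantsHypothesis.ValiantsHypothesis.Theorems.MatrixDescartes.Negative
open Summit.ValiantsHypothesis.ValiantsHypothesis.Theorems.LacunarySymmetroidMatrixDescartes
open Summit.ValiantsHypothesis.ValiantsHypothesis.Theorems.LacunarySymmetroidMatrixDescartes.TropicalCensus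
open scoped BigOperators
open Finset

variable {m K : ℕ}

/-! ## 1. The transportation exchange on class maps -/

/-- symmetric indicator. [folklore] -/
theorem ite_eq_symm (a b : Fin K) : (if a = b then 1 else 0 : ℕ) = (if b = a then 1 else 0 : ℕ) := by
  by_cases h : a = b
  · rw [if_pos h, if_pos h.symm]
  · rw [if_neg h, if_neg (fun h' => h h'.symm)]

/-- counting over `insert`. [folklore] -/
theorem card_filter_insert_eq {S : Finset (Fin m)} {b : Fin m} (hb : b ∉ S) (P : Fin m → Prop) [DecidablePred P] :
    ((insert b S).filter P).card = (S.filter P).card + (if P b then 1 else 0) := by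
  rw [filter_insert]
  split_ifs with h
  · rw [card_insert_of_notMem (fun h' => hb (mem_filter.mp h').1)]
  · rw [add_zero]

/-- **Transportation exchange (combinatorial core).**  On a column set `T`, if `λ` uses class `i` more often than `μ`, then some class `j`
is used less often by `λ` than by `μ` on `T`, and on some `S ⊆ T` swapping `λ` and `μ` trades exactly one `i` for one `j`:
`#{b ∈ S : λ b = l} + [l = j] = #{b ∈ S : μ b = l} + [l = i]` for every class `l`. [folklore] -/
theorem exchange_core (lam mu : Fin m → Fin K) (T : Finset (Fin m)) :
    ∀ i : Fin K, (T.filter fun b => mu b = i).card < (T.filter fun b => lam b = i).card →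
      ∃ j : Fin K, (T.filter fun b => lam b = j).card < (T.filter fun b => mu b = j).card ∧
        ∃ S : Finset (Fin m), S ⊆ T ∧ ∀ l : Fin K,
          (S.filter fun b => lam b = l).card + (if l = j then 1 else 0) =
            (S.filter fun b => mu b = l).card + (if l = i then 1 else 0) := by
  induction T using Finset.strongInduction with
  | H T ih =>
    intro i hi
    -- a column where `λ` has class `i` and `μ` does not
    obtain ⟨b₁, hb₁T, hlam, hmu⟩ : ∃ b₁ ∈ T, lam b₁ = i ∧ mu b₁ ≠ i := by
      by_contra hcon
      push Not at hcon
      have hsub : (T.filter fun b => lam b = i) ⊆ (T.filter fun b => mu b = i) := by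
        intro b hb
        rw [mem_filter] at hb ⊢
        exact ⟨hb.1, hcon b hb.1 hb.2⟩
      exact absurd (card_le_card hsub) (not_le.mpr hi)
    set T' := T.erase b₁ with hT'
    have hTT' : T = insert b₁ T' := (insert_erase hb₁T).symm
    have hb₁T' : b₁ ∉ T' := notMem_erase b₁ T
    have hdecL : ∀ l, (T.filter fun b => lam b = l).card = (T'.filter fun b => lam b = l).card + (if lam b₁ = l then 1 else 0) :=
      fun l => by rw [hTT', card_filter_insert_eq hb₁T']
    have hdecM : ∀ l, (T.filter fun b => mu b = l).card = (T'.filter fun b => mu b = l).card + (if mu b₁ = l then 1 else 0) :=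
      fun l => by rw [hTT', card_filter_insert_eq hb₁T']
    by_cases hA : (T.filter fun b => lam b = mu b₁).card < (T.filter fun b => mu b = mu b₁).card
    · -- one column suffices
      refine ⟨mu b₁, hA, {b₁}, singleton_subset_iff.mpr hb₁T, fun l => ?_⟩
      rw [filter_singleton, filter_singleton, hlam]
      by_cases h1 : i = l
      · by_cases h2 : mu b₁ = l
        · exact absurd (h2.trans h1.symm) hmu
        · rw [if_pos h1, if_neg h2, if_neg (fun h => h2 h.symm), if_pos h1.symm, card_singleton, card_empty]
      · by_cases h2 : mu b₁ = l
        · rw [if_neg h1, if_pos h2, if_pos h2.symm, if_neg (fun h => h1 h.symm), card_singleton, card_empty]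
        · rw [if_neg h1, if_neg h2, if_neg (fun h => h2 h.symm), if_neg (fun h => h1 h.symm), card_empty]
    · -- follow the path through `j₁ = μ b₁` on the smaller column set
      push Not at hA
      have hj₁ : (T'.filter fun b => mu b = mu b₁).card < (T'.filter fun b => lam b = mu b₁).card := by
        have h1 := hdecL (mu b₁)
        have h2 := hdecM (mu b₁)
        rw [if_neg (by rw [hlam]; exact fun h => hmu h.symm)] at h1
        rw [if_pos rfl] at h2
        omega
      obtain ⟨j, hj, S', hS'T', hS'⟩ := ih T' (erase_ssubset hb₁T) (mu b₁) hj₁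
      have hb₁S' : b₁ ∉ S' := fun h => hb₁T' (hS'T' h)
      refine ⟨j, ?_, insert b₁ S', insert_subset hb₁T (hS'T'.trans (erase_subset _ _)), fun l => ?_⟩
      · -- `j` is under-used by `λ` on all of `T`
        have h1 := hdecL j
        have h2 := hdecM j
        have hS'i := hS' i
        have hji : j ≠ i := by
          intro hji
          subst hji
          have h3 := hdecL j
          have h4 := hdecM j
          rw [if_pos hlam] at h3
          rw [if_neg hmu] at h4
          omega
        rw [hlam, if_neg (fun h => hji h.symm)] at h1
        split_ifs at h2 <;> omega
      · rw [card_filter_insert_eq hb₁S', card_filter_insert_eq hb₁S', hlam]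
        have hS'l := hS' l
        rw [ite_eq_symm i l]
        rw [ite_eq_symm l (mu b₁)] at hS'l
        omega

/-! ## 2. Single-permutation sub-patterns are in the exchange sector -/

/-- counting a piecewise class map. [folklore] -/
theorem card_filter_piecewise (S : Finset (Fin m)) (f g : Fin m → Fin K) (l : Fin K) :
    (univ.filter fun b => (if b ∈ S then f b else g b) = l).card =
      (S.filter fun b => f b = l).card + ((univ \ S).filter fun b => g b = l).card := by
  classical
  rw [← card_union_of_disjoint (disjoint_sdiff.mono_left (filter_subset _ S) |>.mono_right (filter_subset _ _))]
  congr 1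
  ext b
  simp only [mem_filter, mem_univ, true_and, mem_union, mem_sdiff]
  by_cases hb : b ∈ S <;> simp [hb]

/-- splitting a class count along `S`. [folklore] -/
theorem card_filter_split (S : Finset (Fin m)) (f : Fin m → Fin K) (l : Fin K) :
    (univ.filter fun b => f b = l).card = (S.filter fun b => f b = l).card + ((univ \ S).filter fun b => f b = l).card := by
  classical
  rw [← card_union_of_disjoint (disjoint_sdiff.mono_left (filter_subset _ S) |>.mono_right (filter_subset _ _))]
  congr 1
  ext b
  simp only [mem_filter, mem_univ, true_and, mem_union, mem_sdiff]
  tauto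

/-- a term present in the single-permutation sub-pattern `εσ` has permutation `σ`, and its classes are present in `ε`. [folklore] -/
theorem perm_eq_of_present_singlePerm (ε : Fin m → Fin m → Fin K → ℤ) (σ : Equiv.Perm (Fin m))
    (q : Equiv.Perm (Fin m) × (Fin m → Fin K))
    (hq : termSign (fun a b l => if a = σ b then ε a b l else 0) q ≠ 0) :
    q.1 = σ ∧ ∀ b, ε (σ b) b (q.2 b) ≠ 0 := by
  rw [termSign_ne_zero_iff] at hq
  have hperm : ∀ b, q.1 b = σ b := by
    intro b
    have := hq b
    by_contra h
    exact this (by simp [h])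
  refine ⟨Equiv.ext hperm, fun b => ?_⟩
  have := hq b
  simpa [hperm b] using this

/-- a term with permutation `σ` whose classes are present in `ε` is present in `εσ`. [folklore] -/
theorem present_singlePerm_of (ε : Fin m → Fin m → Fin K → ℤ) (σ : Equiv.Perm (Fin m)) (r : Fin m → Fin K)
    (hr : ∀ b, ε (σ b) b (r b) ≠ 0) :
    termSign (fun a b l => if a = σ b then ε a b l else 0) (σ, r) ≠ 0 := by
  rw [termSign_ne_zero_iff]
  intro b
  simpa using hr b

/-- **SINGLE-PERMUTATION SUB-PATTERNS SATISFY THE EXCHANGE AXIOM** (with equality in the value inequality): for every design `(v, ε)`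
and every permutation `σ`, the sub-pattern `εσ a b l = [a = σ b]·ε a b l` is in the exchange sector. [folklore: M-concavity of
transportation optima, Murota 2003 Ch. 9; kernel proof: `exchange_core` + swapping the two class maps on `S`] -/
theorem exchange_of_singlePerm (v ε : Fin m → Fin m → Fin K → ℤ) (σ : Equiv.Perm (Fin m)) :
    ∀ p q : Equiv.Perm (Fin m) × (Fin m → Fin K),
      termSign (fun a b l => if a = σ b then ε a b l else 0) p ≠ 0 →
      termSign (fun a b l => if a = σ b then ε a b l else 0) q ≠ 0 →
      ∀ i : Fin K, (univ.filter fun b => q.2 b = i).card < (univ.filter fun b => p.2 b = i).card →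
        ∃ j : Fin K, (univ.filter fun b => p.2 b = j).card < (univ.filter fun b => q.2 b = j).card ∧
          ∃ p' q' : Equiv.Perm (Fin m) × (Fin m → Fin K),
            termSign (fun a b l => if a = σ b then ε a b l else 0) p' ≠ 0 ∧
            termSign (fun a b l => if a = σ b then ε a b l else 0) q' ≠ 0 ∧
            (∀ l, (univ.filter fun b => p'.2 b = l).card + (if l = i then 1 else 0) =
              (univ.filter fun b => p.2 b = l).card + (if l = j then 1 else 0)) ∧
            (∀ l, (univ.filter fun b => q'.2 b = l).card + (if l = j then 1 else 0) =
              (univ.filter fun b => q.2 b = l).card + (if l = i then 1 else 0)) ∧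
            (∑ b, v (p'.1 b) b (p'.2 b)) + (∑ b, v (q'.1 b) b (q'.2 b)) ≤
              (∑ b, v (p.1 b) b (p.2 b)) + (∑ b, v (q.1 b) b (q.2 b)) := by
  classical
  intro p q hp hq i hi
  obtain ⟨hpσ, hpε⟩ := perm_eq_of_present_singlePerm ε σ p hp
  obtain ⟨hqσ, hqε⟩ := perm_eq_of_present_singlePerm ε σ q hq
  have hi' : (univ.filter fun b => q.2 b = i).card < ((univ : Finset (Fin m)).filter fun b => p.2 b = i).card := hi
  obtain ⟨j, hj, S, -, hS⟩ := exchange_core p.2 q.2 univ i hi'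
  refine ⟨j, hj, (σ, fun b => if b ∈ S then q.2 b else p.2 b), (σ, fun b => if b ∈ S then p.2 b else q.2 b),
    present_singlePerm_of ε σ _ (fun b => by split_ifs <;> simp_all),
    present_singlePerm_of ε σ _ (fun b => by split_ifs <;> simp_all), ?_, ?_, ?_⟩
  · intro l
    have h1 := card_filter_piecewise S q.2 p.2 l
    have h2 := card_filter_split S p.2 l
    have h3 := hS l
    simp only at h1 ⊢
    omega
  · intro l
    have h1 := card_filter_piecewise S p.2 q.2 l
    have h2 := card_filter_split S q.2 l
    have h3 := hS l
    simp only at h1 ⊢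
    omega
  · rw [hpσ, hqσ]
    apply le_of_eq
    simp only
    rw [← sum_add_distrib, ← sum_add_distrib]
    refine sum_congr rfl fun b _ => ?_
    split_ifs <;> ring

/-! ## 3. Covers of the chain; the permutation count as an exchange cover -/

/-- **Cover law, chain form**: as `chain_succ_le_of_exchange_cover` (part 3), but the sub-patterns need only cover the CHAIN's terms.
[this file] -/
theorem chain_succ_le_of_exchange_chainCover (d : Fin K → ℕ) (hd : Monotone d) (v ε : Fin m → Fin m → Fin K → ℤ) {R : ℕ}
    (εs : Fin R → Fin m → Fin m → Fin K → ℤ) (hsub : ∀ r a b l, εs r a b l ≠ 0 → ε a b l ≠ 0)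
    (hex : ∀ r, ∀ p q : Equiv.Perm (Fin m) × (Fin m → Fin K), termSign (εs r) p ≠ 0 → termSign (εs r) q ≠ 0 →
      ∀ i : Fin K, (univ.filter fun b => q.2 b = i).card < (univ.filter fun b => p.2 b = i).card →
        ∃ j : Fin K, (univ.filter fun b => p.2 b = j).card < (univ.filter fun b => q.2 b = j).card ∧
          ∃ p' q' : Equiv.Perm (Fin m) × (Fin m → Fin K), termSign (εs r) p' ≠ 0 ∧ termSign (εs r) q' ≠ 0 ∧
            (∀ l, (univ.filter fun b => p'.2 b = l).card + (if l = i then 1 else 0) =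
              (univ.filter fun b => p.2 b = l).card + (if l = j then 1 else 0)) ∧
            (∀ l, (univ.filter fun b => q'.2 b = l).card + (if l = j then 1 else 0) =
              (univ.filter fun b => q.2 b = l).card + (if l = i then 1 else 0)) ∧
            (∑ b, v (p'.1 b) b (p'.2 b)) + (∑ b, v (q'.1 b) b (q'.2 b)) ≤
              (∑ b, v (p.1 b) b (p.2 b)) + (∑ b, v (q.1 b) b (q.2 b)))
    {n : ℕ} (θ : Fin (n + 1) → ℤ) (p : Fin (n + 1) → Equiv.Perm (Fin m) × (Fin m → Fin K))
    (hθ : StrictMono θ) (hdom : ∀ k, IsDominant d v ε (θ k) (p k)) (hne : ∀ k : Fin n, p k.castSucc ≠ p k.succ)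
    (hcover : ∀ k, ∃ r, termSign (εs r) (p k) ≠ 0) :
    n + 1 ≤ R * (m * (K - 1) + 1) := by
  classical
  choose r hr using hcover
  set Φ : Fin (n + 1) → ℕ := fun k => ∑ b, (((p k).2 b : ℕ)) with hΦ
  have hsm := slope_strictMono_of_chainD d v ε θ p hθ hdom hne
  have key : ∀ k k', k < k' → r k = r k' → Φ k < Φ k' := by
    intro k k' hlt hrk
    have hdk : IsDominant d v (εs (r k)) (θ k) (p k) := isDominant_of_sub d v ε _ (hsub _) (hdom k) (hr k)
    have hdk' : IsDominant d v (εs (r k)) (θ k') (p k') :=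
      isDominant_of_sub d v ε _ (hsub _) (hdom k') (by rw [hrk]; exact hr k')
    have hup := upper_le_of_dominant d hd v (εs (r k)) (hex (r k)) (hθ hlt) hdk hdk'
    exact rankSum_lt_of_upper_le d hup (ne_of_lt (hsm hlt))
  have hinj : Function.Injective fun k => (r k, Φ k) := by
    intro k k' hkk'
    simp only [Prod.mk.injEq] at hkk'
    obtain ⟨hrk, hΦk⟩ := hkk'
    by_contra hne'
    rcases lt_or_gt_of_ne hne' with hlt | hlt
    · have := key k k' hlt hrk; omega
    · have := key k' k hlt hrk.symm; omega
  have hrange : ∀ k, (fun k => (r k, Φ k)) k ∈ (univ : Finset (Fin R)) ×ˢ range (m * (K - 1) + 1) := by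
    intro k
    simp only [mem_product, mem_univ, true_and, mem_range]
    exact Nat.lt_succ_of_le (rankSum_le (p k).2)
  have hcard := card_le_card_of_injOn (s := (univ : Finset (Fin (n + 1))))
    (t := (univ : Finset (Fin R)) ×ˢ range (m * (K - 1) + 1)) (fun k => (r k, Φ k)) (fun k _ => hrange k)
    (fun a _ b _ h => hinj h)
  rw [card_univ, Fintype.card_fin, card_product, card_univ, Fintype.card_fin, card_range] at hcard
  exact hcard

/-- **The permutation count is an exchange cover** (re-derivation of `…TropicalBSwitchBudget.chain_le_card_perms_mul` for sorted exponents
and distinct consecutive terms): covering a dominant chain by the single-permutation sub-patterns of its own permutations gives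
`n + 1 ≤ #{σₖ}·(m(K−1)+1)`. [folklore; this derivation: this file] -/
theorem chain_succ_le_card_perms_of_exchange (d : Fin K → ℕ) (hd : Monotone d) (v ε : Fin m → Fin m → Fin K → ℤ)
    {n : ℕ} (θ : Fin (n + 1) → ℤ) (p : Fin (n + 1) → Equiv.Perm (Fin m) × (Fin m → Fin K))
    (hθ : StrictMono θ) (hdom : ∀ k, IsDominant d v ε (θ k) (p k)) (hne : ∀ k : Fin n, p k.castSucc ≠ p k.succ) :
    n + 1 ≤ (univ.image fun k => (p k).1).card * (m * (K - 1) + 1) := by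
  classical
  set Pm := univ.image fun k => (p k).1 with hPm
  set e := Pm.equivFin with he
  refine chain_succ_le_of_exchange_chainCover d hd v ε (R := Pm.card)
    (fun r => fun a b l => if a = (e.symm r : Equiv.Perm (Fin m)) b then ε a b l else 0)
    (fun r a b l h => by by_contra h0; exact h (by simp only [h0, ite_self])) (fun r => exchange_of_singlePerm v ε _)
    θ p hθ hdom hne fun k => ?_
  have hmem : (p k).1 ∈ Pm := mem_image.mpr ⟨k, mem_univ _, rfl⟩
  refine ⟨e ⟨(p k).1, hmem⟩, ?_⟩
  have hσ : ((e.symm (e ⟨(p k).1, hmem⟩) : Pm) : Equiv.Perm (Fin m)) = (p k).1 := by rw [Equiv.symm_apply_apply]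
  rw [hσ]
  have hpres := (termSign_ne_zero_iff ε (p k)).mp (hdom k).1
  have := present_singlePerm_of ε (p k).1 (p k).2 hpres
  rwa [Prod.mk.eta] at this

end Summit.ValiantsHypothesis.ValiantsHypothesis.Theorems.KPlusLogSqLaw.ExchangeSector
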